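import Mathlib
import Summits.PneNP.PneNP.Theorems.ConvexRankGatesConvexGateBlindExactLiftingTriangleMass
import Summits.PneNP.PneNP.Theorems.ConvexRankGatesConvexGateBlindExactLiftingTrianglePsi
import Summits.PneNP.PneNP.Theorems.ConvexRankGatesConvexGateBlindExactLiftingTriangleLineBridge
import Literature.NumberTheory.Sieve.RosserSieveSums

/-!
# PneNP / ConvexRankGates — `ConvexGateBlind`, line `xor-door-perfect-completeness`:
# at every FIXED shift the triangle instance has non-negative rank `t^{3−o(1)}` (prover seat 0, session 21)

Helper toward crux item stmt-PneNP-10680 (`--supports`; open stub `stub_exactLifting`; lead c5's instance of record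
`TriangleInst.triM`, here in the pulled-back vocabulary `Col`, `Tri`, `monoCount` of `…TriangleLineCover`).
Memo ANALYSIS11, Theorem A:

* `fixed_shift_bound` / registered `triangle_fixed_shift_bound`: for `t ≥ 3`, `0 < ε ≤ 1` and every non-negative
  factorisation `M_t[x,w] − ε = Σ_{l<R} u_l(x) v_l(w)` of the shifted triangle matrix,
  `ε^{11} · t³ ≤ 10^{19} · (ln t)⁴ · R`;
* `triM_fixed_shift_bound`: the same for `TriangleInst.triM t − ε` (pull-back along `fC`, `fT`);
* `triangle_fixed_shift_eventually`: for every `ε ∈ (0,1]` and every `C`, eventually in `t`, every such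
  factorisation has `C · t² ≤ R`.

So the exponent of `rk₊(M_t − εJ)` is `3` at EVERY positive shift (it is `≤ 3t²` at `ε = 0`); a strict
factorisation of `M_t` with `O(t²)` terms can only live at vanishing shifts `ε(t) → 0` — the order of limits
(`ε → 0⁺` before `t → ∞`, i.e. `rk₊₊`) is exactly what this file does not touch.
Proof: the mass inequality `ε t³ 8^t ≤ 12 Σ_l breadth(v_l)·#{x : share_x(v_l) ≥ 1/2 + ε/12}` (`mass_bound`,
`…TriangleMass`) against Lemma Ψ (`breadth_share_le`, `…TrianglePsi`) with `η = 3c²/(8 ln t)`, `η' = 9c²/(512 ln t)`,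
`c = ε/12` (`psi_numeric`: the bound is `≤ 6·10⁶ ln⁴t/c^{10}` per term).  Elementary; no definitions.
-/

set_option linter.dupNamespace false -- `Summit.PneNP.PneNP.…`: summit = sub-problem (D-0017)

namespace Summit.PneNP.PneNP.Theorems.XorDoor.TriLine

open scoped BigOperators
open Finset Real Filter

noncomputable section

variable {t : ℕ}

/-! ## §1 Numerics -/

/-- `1 ≤ ln t` for `t ≥ 3` (from the tree's `1 ≤ ln 3`, `Literature.NumberTheory.Sieve.BetaSieve.one_le_log_three`) -/
lemma one_le_log_nat (ht : 3 ≤ t) : (1 : ℝ) ≤ Real.log t :=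
  Literature.NumberTheory.Sieve.BetaSieve.one_le_log_three.trans
    (Real.log_le_log (by norm_num) (by exact_mod_cast ht))

/-- The numeric heart of the parameter choice `η = 3c²/(8L)`, `η' = 9c²/(512L)`, `T = e^L`, `L ≥ 1`, `0 < c ≤ 1`:
`T³ e^{−9c²/(8η)} + 2T³ e^{−9(c/4)²/(8η')}/η + 256/(c²η²η'²) ≤ 6·10⁶ L⁴/c^{10}`. -/
lemma psi_numeric {L c T : ℝ} (hL : 1 ≤ L) (hc0 : 0 < c) (hc1 : c ≤ 1) (hT : Real.exp L = T) :
    T ^ 3 * exp (-(9 * c ^ 2 / (8 * (3 * c ^ 2 / (8 * L)))))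
      + 2 * T ^ 3 * exp (-(9 * (c / 4) ^ 2 / (8 * (9 * c ^ 2 / (512 * L))))) / (3 * c ^ 2 / (8 * L))
      + 256 / (c ^ 2 * (3 * c ^ 2 / (8 * L)) ^ 2 * (9 * c ^ 2 / (512 * L)) ^ 2)
      ≤ 6000000 * L ^ 4 / c ^ 10 := by
  have hL0 : 0 < L := by linarith
  have hT0 : 0 < T := by rw [← hT]; exact exp_pos _
  have hT1 : 1 ≤ T := by rw [← hT]; exact one_le_exp hL0.le
  have hc : c ≠ 0 := hc0.ne'
  -- the two exponents
  have h1 : 9 * c ^ 2 / (8 * (3 * c ^ 2 / (8 * L))) = 3 * L := by field_simp; ring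
  have h2 : 9 * (c / 4) ^ 2 / (8 * (9 * c ^ 2 / (512 * L))) = 4 * L := by field_simp; ring
  rw [h1, h2]
  have hT3 : exp (-(3 * L)) = (T ^ 3)⁻¹ := by
    rw [exp_neg, ← hT, ← exp_nat_mul]; norm_num
  have hT4 : exp (-(4 * L)) = (T ^ 4)⁻¹ := by
    rw [exp_neg, ← hT, ← exp_nat_mul]; norm_num
  rw [hT3, hT4]
  have e1 : T ^ 3 * (T ^ 3)⁻¹ = 1 := mul_inv_cancel₀ (by positivity)
  have e2 : 2 * T ^ 3 * (T ^ 4)⁻¹ / (3 * c ^ 2 / (8 * L)) = 16 * L / (3 * c ^ 2 * T) := by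
    field_simp; ring
  have e3 : 256 / (c ^ 2 * (3 * c ^ 2 / (8 * L)) ^ 2 * (9 * c ^ 2 / (512 * L)) ^ 2)
      = 4294967296 * L ^ 4 / (729 * c ^ 10) := by
    field_simp; ring
  rw [e1, e2, e3]
  -- elementary bounds
  have hc8 : c ^ 8 ≤ 1 := pow_le_one₀ hc0.le hc1
  have hc10 : c ^ 10 ≤ c ^ 2 := by nlinarith [sq_nonneg c]
  have hL4 : L ≤ L ^ 4 := by
    calc L = L * 1 := by ring
      _ ≤ L * L ^ 3 := mul_le_mul_of_nonneg_left (one_le_pow₀ hL) hL0.le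
      _ = L ^ 4 := by ring
  have hL41 : 1 ≤ L ^ 4 := one_le_pow₀ hL
  have hc100 : 0 < c ^ 10 := by positivity
  have b1 : (1 : ℝ) ≤ L ^ 4 / c ^ 10 := by
    rw [le_div_iff₀ hc100]; nlinarith
  have b2 : 16 * L / (3 * c ^ 2 * T) ≤ 6 * L ^ 4 / c ^ 10 := by
    rw [div_le_div_iff₀ (by positivity) hc100]
    have key : L * c ^ 10 ≤ L ^ 4 * c ^ 2 * T := by
      calc L * c ^ 10 ≤ L ^ 4 * c ^ 2 := mul_le_mul hL4 hc10 hc100.le (by positivity)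
        _ = L ^ 4 * c ^ 2 * 1 := by ring
        _ ≤ L ^ 4 * c ^ 2 * T := mul_le_mul_of_nonneg_left hT1 (by positivity)
    have hpos : 0 ≤ L ^ 4 * c ^ 2 * T := by positivity
    linarith
  have b3 : 4294967296 * L ^ 4 / (729 * c ^ 10) ≤ 5900000 * L ^ 4 / c ^ 10 := by
    rw [div_le_div_iff₀ (by positivity) hc100]
    have : 0 ≤ L ^ 4 * c ^ 10 * c ^ 10 := by positivity
    nlinarith
  have e : ∀ k : ℝ, k * L ^ 4 / c ^ 10 = k * (L ^ 4 / c ^ 10) := fun k => mul_div_assoc _ _ _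
  rw [e] at b2 b3 ⊢
  linarith

/-! ## §2 The fixed-shift bound -/

/-- **Theorem A of ANALYSIS11.** For `t ≥ 3`, `0 < ε ≤ 1` and every non-negative factorisation of `M_t − ε` into
`R` rank-one terms: `ε^{11} t³ ≤ 10^{19} (ln t)⁴ R`. -/
theorem fixed_shift_bound {R : ℕ} (ht : 3 ≤ t) {ε : ℝ} (hε0 : 0 < ε) (hε1 : ε ≤ 1)
    {u : Col t → Fin R → ℝ} {v : Fin R → Tri t → ℝ} (hu : ∀ x l, 0 ≤ u x l) (hv : ∀ l w, 0 ≤ v l w)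
    (hfact : ∀ x w, (monoCount x w : ℝ) - ε = ∑ l, u x l * v l w) :
    ε ^ 11 * (t : ℝ) ^ 3 ≤ 10 ^ 19 * Real.log t ^ 4 * R := by
  -- peaks of the column factors
  have h0t : 0 < t := by omega
  have hne : (univ : Finset (Tri t)).Nonempty := ⟨(⟨0, h0t⟩, ⟨0, h0t⟩, ⟨0, h0t⟩), mem_univ _⟩
  have hpk : ∀ l, ∃ w0, ∀ w, v l w ≤ v l w0 := fun l => by
    obtain ⟨w0, -, hw0⟩ := exists_max_image univ (v l) hne
    exact ⟨w0, fun w => hw0 w (mem_univ w)⟩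
  choose wmax hwmax using hpk
  -- the mass inequality
  have hM := mass_bound (wmax := wmax) hε0 hε1 hu hv hwmax hfact
  -- Lemma Ψ, term by term
  have hL : 1 ≤ Real.log t := one_le_log_nat ht
  have hL0 : 0 < Real.log t := by linarith
  have ht0 : (0 : ℝ) < t := by exact_mod_cast h0t
  have hexp : Real.exp (Real.log t) = t := Real.exp_log ht0
  have hc0 : 0 < ε / 12 := by positivity
  have hc1 : ε / 12 ≤ 1 := by linarith
  have hterm : ∀ l, (∑ w, v l w) / v l (wmax l) *
      #(univ.filter fun x : Col t => (1 / 2 + ε / 12) * ∑ w, v l w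
        ≤ ∑ w ∈ univ.filter (fun w : Tri t => IsMono x w.1 w.2.1 w.2.2), v l w)
        ≤ 8 ^ t * (6000000 * Real.log t ^ 4 / (ε / 12) ^ 10) := by
    intro l
    by_cases hV : ∑ w, v l w = 0
    · rw [hV, zero_div, zero_mul]; positivity
    · have hVpos : 0 < ∑ w, v l w := lt_of_le_of_ne (sum_nonneg fun w _ => hv l w) (Ne.symm hV)
      have hη : 0 < 3 * (ε / 12) ^ 2 / (8 * Real.log t) := by positivity
      have hη' : 0 < 9 * (ε / 12) ^ 2 / (512 * Real.log t) := by positivity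
      exact (breadth_share_le (v l) (hv l) (hwmax l) hVpos hc0 hη hη').trans
        (mul_le_mul_of_nonneg_left (psi_numeric hL hc0 hc1 hexp) (by positivity))
  have hsum : ∑ l, (∑ w, v l w) / v l (wmax l) *
      #(univ.filter fun x : Col t => (1 / 2 + ε / 12) * ∑ w, v l w
        ≤ ∑ w ∈ univ.filter (fun w : Tri t => IsMono x w.1 w.2.1 w.2.2), v l w)
        ≤ R * (8 ^ t * (6000000 * Real.log t ^ 4 / (ε / 12) ^ 10)) := by
    calc _ ≤ ∑ _l : Fin R, 8 ^ t * (6000000 * Real.log t ^ 4 / (ε / 12) ^ 10) := sum_le_sum fun l _ => hterm l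
      _ = R * (8 ^ t * (6000000 * Real.log t ^ 4 / (ε / 12) ^ 10)) := by
          rw [sum_const, card_univ, Fintype.card_fin, nsmul_eq_mul]
  -- divide by `8^t`
  have h8 : (0 : ℝ) < 8 ^ t := by positivity
  have key : ε * (t : ℝ) ^ 3 ≤ 12 * R * (6000000 * Real.log t ^ 4 / (ε / 12) ^ 10) := by
    refine le_of_mul_le_mul_right ?_ h8
    calc ε * (t : ℝ) ^ 3 * 8 ^ t ≤ _ := hM
      _ ≤ 12 * (R * (8 ^ t * (6000000 * Real.log t ^ 4 / (ε / 12) ^ 10))) := by linarith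
      _ = 12 * R * (6000000 * Real.log t ^ 4 / (ε / 12) ^ 10) * 8 ^ t := by ring
  -- clear the denominator `ε^{10}`
  have hR : (0 : ℝ) ≤ R := Nat.cast_nonneg R
  have hε10 : (0 : ℝ) < ε ^ 10 := by positivity
  calc ε ^ 11 * (t : ℝ) ^ 3 = ε ^ 10 * (ε * t ^ 3) := by ring
    _ ≤ ε ^ 10 * (12 * R * (6000000 * Real.log t ^ 4 / (ε / 12) ^ 10)) :=
        mul_le_mul_of_nonneg_left key hε10.le
    _ = 72000000 * 12 ^ 10 * Real.log t ^ 4 * R := by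
        field_simp
        ring
    _ ≤ 10 ^ 19 * Real.log t ^ 4 * R := by
        have : (0 : ℝ) ≤ Real.log t ^ 4 * R := by positivity
        nlinarith

/-- **Theorem A of ANALYSIS11** (registered sub-goal `triangle_fixed_shift_bound` of stmt-PneNP-10680, explicit
vocabulary): at every fixed shift `ε ∈ (0,1]` the triangle matrix has non-negative rank `≥ ε^{11} t³/(10^{19} ln⁴ t)`. -/
theorem triangle_fixed_shift_bound :
    ∀ (t R : ℕ), 3 ≤ t → ∀ (ε : ℝ), 0 < ε → ε ≤ 1 →
    ∀ (u : (Fin t → Bool) × (Fin t → Bool) × (Fin t → Bool) → Fin R → ℝ) (v : Fin R → Fin t × Fin t × Fin t → ℝ),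
    (∀ x l, 0 ≤ u x l) → (∀ l w, 0 ≤ v l w) →
    (∀ x w, (((if x.1 w.1 = x.2.1 w.2.1 then 1 else 0) + (if x.1 w.1 = x.2.2 w.2.2 then 1 else 0) +
      (if x.2.1 w.2.1 = x.2.2 w.2.2 then 1 else 0) : ℕ) : ℝ) - ε = ∑ l, u x l * v l w) →
    ε ^ 11 * (t : ℝ) ^ 3 ≤ 10 ^ 19 * Real.log t ^ 4 * R :=
  fun _ _ ht _ hε0 hε1 _ _ hu hv hfact =>
    fixed_shift_bound ht hε0 hε1 hu hv (fun x w => by simpa [monoCount] using hfact x w)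

/-- **Theorem A on lead c5's instance of record `TriangleInst.triM`.** For `t ≥ 3`, `0 < ε ≤ 1` and every
non-negative factorisation `triM t x w − ε = Σ_{l<R} u_l(x) v_l(w)` over `𝔽₂`-tables and pointer maps:
`ε^{11} t³ ≤ 10^{19} (ln t)⁴ R`. -/
theorem triM_fixed_shift_bound {R : ℕ} (ht : 3 ≤ t) {ε : ℝ} (hε0 : 0 < ε) (hε1 : ε ≤ 1)
    {u : (Fin 3 → Fin t → ZMod 2) → Fin R → ℝ} {v : Fin R → (Fin 3 → Fin t) → ℝ}
    (hu : ∀ x l, 0 ≤ u x l) (hv : ∀ l w, 0 ≤ v l w)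
    (hfact : ∀ x w, TriangleInst.triM t x w - ε = ∑ l, u x l * v l w) :
    ε ^ 11 * (t : ℝ) ^ 3 ≤ 10 ^ 19 * Real.log t ^ 4 * R :=
  fixed_shift_bound (u := fun x l => u (fC x) l) (v := fun l w => v l (fT w)) ht hε0 hε1
    (fun _ _ => hu _ _) (fun _ _ => hv _ _) (fun x w => by rw [monoCount_pullback]; exact hfact _ _)

/-! ## §3 Eventual form -/

/-- `ln⁴ t / t → 0`: eventually `10^{19} ln⁴ t · C ≤ ε^{11} t`. -/
lemma eventually_log_pow_four_le {a : ℝ} (ha : 0 < a) :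
    ∀ᶠ t : ℕ in atTop, Real.log t ^ 4 ≤ a * t := by
  have h := Real.tendsto_pow_log_div_mul_add_atTop 1 0 4 one_ne_zero
  have h' : ∀ᶠ x : ℝ in atTop, Real.log x ^ 4 / (1 * x + 0) ≤ a :=
    (h.eventually (ge_mem_nhds ha))
  have h'' := (h'.and (eventually_gt_atTop 0))
  obtain ⟨X, hX⟩ := eventually_atTop.1 h''
  refine eventually_atTop.2 ⟨⌈X⌉₊, fun t ht => ?_⟩
  have hxt : X ≤ (t : ℝ) := (Nat.le_ceil X).trans (by exact_mod_cast ht)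
  obtain ⟨h1, h2⟩ := hX t hxt
  rw [one_mul, add_zero, div_le_iff₀ h2] at h1
  exact h1

/-- **Eventual form of Theorem A**: for every fixed shift `ε ∈ (0,1]` and every constant `C`, eventually in `t`,
every non-negative factorisation of `M_t − ε` has at least `C·t²` terms (while `M_t` itself has one with `3t²`). -/
theorem triangle_fixed_shift_eventually {ε : ℝ} (hε0 : 0 < ε) (hε1 : ε ≤ 1) (C : ℝ) :
    ∀ᶠ t : ℕ in atTop, ∀ (R : ℕ) (u : Col t → Fin R → ℝ) (v : Fin R → Tri t → ℝ),
      (∀ x l, 0 ≤ u x l) → (∀ l w, 0 ≤ v l w) →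
      (∀ x w, (monoCount x w : ℝ) - ε = ∑ l, u x l * v l w) → C * (t : ℝ) ^ 2 ≤ R := by
  have ha : 0 < ε ^ 11 / (10 ^ 19 * (max C 1)) := by positivity
  filter_upwards [eventually_log_pow_four_le ha, eventually_ge_atTop 3] with t ht ht3 R u v hu hv hfact
  have hb := fixed_shift_bound ht3 hε0 hε1 hu hv hfact
  have ht0 : (0 : ℝ) < t := by exact_mod_cast (by omega : 0 < t)
  have hC : C ≤ max C 1 := le_max_left _ _
  have hM1 : (1 : ℝ) ≤ max C 1 := le_max_right _ _
  -- `10^19 ln⁴t ≤ ε^11 t / max C 1`, so `ε^11 t³ ≤ 10^19 ln⁴ t R ≤ ε^11 t R / max C 1`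
  have h1 : 10 ^ 19 * Real.log t ^ 4 * (max C 1) ≤ ε ^ 11 * t := by
    have hpos : (0 : ℝ) < 10 ^ 19 * max C 1 := by positivity
    have := mul_le_mul_of_nonneg_left ht hpos.le
    calc 10 ^ 19 * Real.log t ^ 4 * max C 1 = (10 ^ 19 * max C 1) * Real.log t ^ 4 := by ring
      _ ≤ (10 ^ 19 * max C 1) * (ε ^ 11 / (10 ^ 19 * max C 1) * t) := this
      _ = ε ^ 11 * t := by field_simp
  have hR : (0 : ℝ) ≤ R := Nat.cast_nonneg R
  have h2 : ε ^ 11 * (t : ℝ) ^ 3 * max C 1 ≤ ε ^ 11 * t * R := by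
    calc ε ^ 11 * (t : ℝ) ^ 3 * max C 1 ≤ 10 ^ 19 * Real.log t ^ 4 * R * max C 1 :=
          mul_le_mul_of_nonneg_right hb (by positivity)
      _ = 10 ^ 19 * Real.log t ^ 4 * max C 1 * R := by ring
      _ ≤ ε ^ 11 * t * R := mul_le_mul_of_nonneg_right h1 hR
  have hε11 : (0 : ℝ) < ε ^ 11 * t := by positivity
  have h3 : (t : ℝ) ^ 2 * max C 1 ≤ R := by
    have : ε ^ 11 * t * ((t : ℝ) ^ 2 * max C 1) ≤ ε ^ 11 * t * R := by
      calc ε ^ 11 * t * ((t : ℝ) ^ 2 * max C 1) = ε ^ 11 * (t : ℝ) ^ 3 * max C 1 := by ring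
        _ ≤ ε ^ 11 * t * R := h2
    exact le_of_mul_le_mul_left this hε11
  nlinarith [sq_nonneg (t : ℝ)]

end

end Summit.PneNP.PneNP.Theorems.XorDoor.TriLine
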